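import Literature.AlgebraicGeometry.Motives.HirschowitzIyerParameterCurve
import Literature.AlgebraicGeometry.Motives.HirschowitzIyerGenericLine
import Literature.AlgebraicGeometry.Motives.ProjFamilySpecialization
import Literature.AlgebraicGeometry.Motives.VerticalLimitsOfLines
import Literature.AlgebraicGeometry.Motives.ProjectiveSpaceFieldPointsFunctorial
import Literature.AlgebraicGeometry.Motives.HirschowitzIyerSurjectivity
import Literature.AlgebraicGeometry.Motives.GenericFibreRatSpread
import Literature.AlgebraicGeometry.Motives.ProjBaseChangeAny
import Literature.AlgebraicGeometry.Resolution.ProjectiveModelsFunctionField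
import Literature.AlgebraicGeometry.Resolution.BlowupsFlatBaseChange
import HarnessLib

/-!
# The ruled surface of Hirschowitz–Iyer's Lemma 2.2 (`s = 0`), I: the function field of the parameter curve and the generic fibre `ℙ⁸_{K(Z)} → ℙ⁸ ×_K Z`

Hirschowitz–Iyer 2010, proof of Lemma 2.2 (`s < r`; here `s = 0`, `r = 1`): "We denote by
`H_Z ⊂ H'_Z` the two corresponding projective bundles over `Z` […] We take for `Γ` this
Chow-theoretic projection of `H'_Z` in `Y'` […] applying the projection formula to
`pr₂ : Z × Y' → Y'`". The projective bundle `H'_Z → Z` is realised in this tree as the closure, in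
`ℙ⁸ ×_K Z`, of the generic strong line, a line of the generic fibre `ℙ⁸_{K(Z)}`; cycles are spread
from the generic fibre by `Motives/GenericFibreRatSpread`, which wants the generic fibre PRESENTED
as a cartesian square over a flat quasi-compact preimmersion onto the generic point. This file
provides, for the parameter curve `Z` of `Motives/HirschowitzIyerParameterCurve`:

* `funFieldIso w F' : K(Z) ≅ F'` (the stalk map of the generic point `Spec F' → Z`, an isomorphism:
  `Spec F' → Z` is a flat preimmersion) with `specMap_funFieldIso_hom_fromSpecStalk`, and its
  compatibilities with the `K`-algebra structures (`funFieldIso_hom_algebraMap`) and with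
  `K(W) → K(Z)` (`funFieldIso_hom_functionFieldMap`); `funFieldAlgEquiv : K(Z) ≃ₐ[K] F'`;
* `genFibι w F' : ℙ⁸_{K(Z)} → ℙ⁸ ×_K Z` — the generic fibre, with components `ℙ⁸_{K(Z)} → ℙ⁸_K`
  (`Proj` of `K[x] → K(Z)[x]`) and `ℙ⁸_{K(Z)} → Spec K(Z) → Z` (`genFibι_fst`, `genFibι_snd`), and
  **`isPullback_genFibι`**: the square over `Spec K(Z) → Z` is cartesian (`ℙ⁸_{K(Z)} = ℙ⁸_K ×_K K(Z)`,
  `ProjBaseChangeRing.isPullback_projMap'`, pasted with `ℙ⁸ ×_K Z → Z`).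

## References

* A. Hirschowitz, J. N. N. Iyer, Contemp. Math. 522 (2010), arXiv:0903.5018, §2 Lemma 2.2 (proof).
  [HirschowitzIyer2010]
* Q. Liu, *Algebraic Geometry and Arithmetic Curves* (2002), Ex. 3.1.10, Def. 4.1.24. [Liu2002]
-/

noncomputable section

open CategoryTheory CategoryTheory.Limits AlgebraicGeometry Order MonoidalCategory IsLocalRing TopologicalSpace
open Literature.AlgebraicGeometry.Resolution

universe u

namespace Literature.AlgebraicGeometry.Motives

attribute [local instance] MvPolynomial.gradedAlgebra

section FunctionField

variable {K : Type u} [Field K] {Y : SchemeOver K} (w : Y.left)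
  (F' : Type u) [Field F'] [Algebra (curveField w) F']
  [Algebra K F'] [IsScalarTower K (curveField w) F']

/-- The generic point `Spec F' → Z` hits the generic point. [folklore] -/
theorem paramGen_apply (p : ↥(specOver K F').left) :
    (paramGen w F').left p = genericPoint (paramCurve w F').left := by
  have h : (paramGen w F').left p ∈ Set.range (paramGen w F').left := ⟨p, rfl⟩
  rw [range_paramGen] at h
  exact h

variable [FiniteDimensional (curveField w) F']

/-- `𝒪_{Z,η} → F'`, the stalk map of `Spec F' → Z` at the closed point, is bijective (`Spec F' → Z`
is a flat preimmersion, `K(Z) = F'`). [cite: Liu2002, Def. 4.1.24] -/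
theorem bijective_stalkClosedPointTo :
    Function.Bijective (Scheme.stalkClosedPointTo (paramGen w F').left) := by
  change Function.Bijective (fun x => (stalkClosedPointIso (.of F')).hom
    (((paramGen w F').left.stalkMap (closedPoint F')) x))
  exact (ConcreteCategory.bijective_of_isIso (stalkClosedPointIso (.of F')).hom).comp
    (stalkMap_bijective_of_flat_of_isPreimmersion (paramGen w F').left (closedPoint F'))

/-- Hence an isomorphism. [folklore] -/
instance isIso_stalkClosedPointTo : IsIso (Scheme.stalkClosedPointTo (paramGen w F').left) :=
  (ConcreteCategory.isIso_iff_bijective _).mpr (bijective_stalkClosedPointTo w F')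

/-- **`K(Z) ≅ F'`**: `K(Z) = 𝒪_{Z,ξ} ≅ 𝒪_{Z, gen(pt)} ≅ F'`. [cite: Liu2002, Def. 4.1.24] -/
def funFieldIso : (paramCurve w F').left.functionField ≅ CommRingCat.of F' :=
  (paramCurve w F').left.presheaf.stalkCongr (Inseparable.of_eq (paramGen_apply w F' (closedPoint F')).symm) ≪≫
    asIso (Scheme.stalkClosedPointTo (paramGen w F').left)

/-- **`Spec F' ≅ Spec K(Z) → Z` is the generic point `Spec F' → Z`.** [folklore] -/
@[reassoc (attr := simp)]
theorem specMap_funFieldIso_hom_fromSpecStalk :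
    Spec.map (funFieldIso w F').hom ≫ (paramCurve w F').left.fromSpecStalk (genericPoint (paramCurve w F').left) =
      (paramGen w F').left := by
  rw [funFieldIso, Iso.trans_hom, Spec.map_comp, Category.assoc, TopCat.Presheaf.stalkCongr_hom,
    Scheme.SpecMap_stalkSpecializes_fromSpecStalk, asIso_hom]
  exact Scheme.Spec_stalkClosedPointTo_fromSpecStalk (paramGen w F').left

/-- Ring maps out of a field agreeing after `Spec` agree. [folklore] -/
theorem ringHom_eq_of_specMap_eq {R S : CommRingCat.{u}} {f g : R ⟶ S} (h : Spec.map f = Spec.map g) : f = g :=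
  Spec.map_injective h

/-- **`K(Z) ≅ F'` is `K`-linear**: it carries the structure map `K → K(Z)` (germs of constants,
`Motives.RatFn.algebraStalk`) to `K → F'`. [folklore] -/
theorem funFieldIso_hom_comp_algebraMap :
    CommRingCat.ofHom (algebraMap K (paramCurve w F').left.functionField) ≫ (funFieldIso w F').hom =
      CommRingCat.ofHom (algebraMap K F') := by
  apply ringHom_eq_of_specMap_eq
  rw [Spec.map_comp, ← CurvePlaces.fromSpecStalk_comp_hom (paramCurve w F') (genericPoint _),
    specMap_funFieldIso_hom_fromSpecStalk_assoc]
  exact Over.w (paramGen w F')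

/-- Elementwise form. [folklore] -/
theorem funFieldIso_hom_algebraMap (c : K) :
    (funFieldIso w F').hom (algebraMap K (paramCurve w F').left.functionField c) = algebraMap K F' c := by
  have h := congrArg (fun f => (f : K →+* F') c) (congrArg CommRingCat.Hom.hom (funFieldIso_hom_comp_algebraMap w F'))
  simpa using h

/-- `Z → W` is dominant. [folklore] -/
instance isDominant_paramCurveToCurve_left : IsDominant (paramCurveToCurve w F').left :=
  inferInstanceAs (IsDominant (normalizationInι (curveOf w).left F'))

/-- **`K(Z) ≅ F'` extends `K(W) ⊆ F'`**: composed with the field map `K(W) → K(Z)` of the dominant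
`Z → W` it is the given `K(W) → F'`. [folklore] -/
theorem funFieldIso_hom_comp_functionFieldMap [IsIntegral Y.left] :
    CommRingCat.ofHom (RatFn.functionFieldMap (paramCurveToCurve w F').left) ≫ (funFieldIso w F').hom =
      CommRingCat.ofHom (algebraMap (curveField w) F') := by
  apply ringHom_eq_of_specMap_eq
  rw [Spec.map_comp]
  rw [← cancel_mono ((curveOf w).left.fromSpecStalk (genericPoint (curveOf w).left)), Category.assoc,
    specMap_functionFieldMap_fromSpecStalk, specMap_funFieldIso_hom_fromSpecStalk_assoc, paramCurveToCurve_left,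
    paramGen_left]
  change (fromSpecExtension (curveOf w).left F').toNormalization ≫ (fromSpecExtension (curveOf w).left F').fromNormalization = _
  rw [Scheme.Hom.toNormalization_fromNormalization]
  rfl

/-- Elementwise form. [folklore] -/
theorem funFieldIso_hom_functionFieldMap [IsIntegral Y.left] (a : curveField w) :
    (funFieldIso w F').hom (RatFn.functionFieldMap (paramCurveToCurve w F').left a) = algebraMap (curveField w) F' a := by
  have h := congrArg (fun f => (f : curveField w →+* F') a)
    (congrArg CommRingCat.Hom.hom (funFieldIso_hom_comp_functionFieldMap w F'))
  simpa using h

/-- **`K(Z) ≃ₐ[K] F'`.** [cite: Liu2002, Def. 4.1.24] -/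
def funFieldAlgEquiv : (paramCurve w F').left.functionField ≃ₐ[K] F' :=
  { (funFieldIso w F').commRingCatIsoToRingEquiv with
    commutes' := fun c => funFieldIso_hom_algebraMap w F' c }

/-- Unfolding. [folklore] -/
@[simp] theorem funFieldAlgEquiv_apply (a : (paramCurve w F').left.functionField) :
    funFieldAlgEquiv w F' a = (funFieldIso w F').hom a := rfl

end FunctionField

/-! ### The generic fibre `ℙ⁸_{K(Z)} → ℙ⁸ ×_K Z` -/

section GenericFibre

open ProjBaseChangeRing

variable {K : Type u} [Field K] {Y : SchemeOver K} (w : Y.left)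
  (F' : Type u) [Field F'] [Algebra (curveField w) F']

/-- `ℙ⁸_{K(Z)} → ℙ⁸_K` and `ℙ⁸_{K(Z)} → Spec K(Z) → Z` agree over `Spec K`. [folklore] -/
theorem genFibι_w :
    Proj.map (mapGraded K (paramCurve w F').left.functionField (Fin (8 + 1))) (irrelevant_le_map K (paramCurve w F').left.functionField (Fin (8 + 1))) ≫ (projectiveSpace 8 K).hom =
      (projToSpec (Fin (8 + 1)) (paramCurve w F').left.functionField ≫ (paramCurve w F').left.fromSpecStalk (genericPoint (paramCurve w F').left)) ≫ (paramCurve w F').hom := by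
  rw [Category.assoc, CurvePlaces.fromSpecStalk_comp_hom]
  exact (isPullback_projMap' K (paramCurve w F').left.functionField (n := 8)).w

/-- **The generic fibre `ι : ℙ⁸_{K(Z)} → ℙ⁸ ×_K Z`** (components `ℙ⁸_{K(Z)} → ℙ⁸_K` and
`ℙ⁸_{K(Z)} → Spec K(Z) → Z`). [folklore] -/
def genFibι : (projectiveSpace 8 (paramCurve w F').left.functionField).left ⟶
      ((projectiveSpace 8 K) ⊗ (paramCurve w F')).left :=
  pullback.lift (Proj.map (mapGraded K (paramCurve w F').left.functionField (Fin (8 + 1))) (irrelevant_le_map K (paramCurve w F').left.functionField (Fin (8 + 1))))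
    (projToSpec (Fin (8 + 1)) (paramCurve w F').left.functionField ≫ (paramCurve w F').left.fromSpecStalk (genericPoint (paramCurve w F').left)) (genFibι_w w F')

/-- First component. [folklore] -/
@[reassoc (attr := simp)]
theorem genFibι_fst : genFibι w F' ≫ (CartesianMonoidalCategory.fst (projectiveSpace 8 K) (paramCurve w F')).left =
    Proj.map (mapGraded K (paramCurve w F').left.functionField (Fin (8 + 1))) (irrelevant_le_map K (paramCurve w F').left.functionField (Fin (8 + 1))) :=
  pullback.lift_fst _ _ _

/-- Second component. [folklore] -/
@[reassoc (attr := simp)]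
theorem genFibι_snd : genFibι w F' ≫ (CartesianMonoidalCategory.snd (projectiveSpace 8 K) (paramCurve w F')).left =
    projToSpec (Fin (8 + 1)) (paramCurve w F').left.functionField ≫ (paramCurve w F').left.fromSpecStalk (genericPoint (paramCurve w F').left) :=
  pullback.lift_snd _ _ _

/-- **The generic fibre square is cartesian**: `ℙ⁸_{K(Z)} = (ℙ⁸ ×_K Z) ×_Z Spec K(Z)`.
[cite: Liu2002, Ex. 3.1.10] -/
theorem isPullback_genFibι :
    IsPullback (genFibι w F') (projToSpec (Fin (8 + 1)) (paramCurve w F').left.functionField)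
      (CartesianMonoidalCategory.snd (projectiveSpace 8 K) (paramCurve w F')).left
      ((paramCurve w F').left.fromSpecStalk (genericPoint (paramCurve w F').left)) := by
  have big : IsPullback (genFibι w F' ≫ (CartesianMonoidalCategory.fst (projectiveSpace 8 K) (paramCurve w F')).left)
      (projToSpec (Fin (8 + 1)) (paramCurve w F').left.functionField) (projectiveSpace 8 K).hom
      ((paramCurve w F').left.fromSpecStalk (genericPoint (paramCurve w F').left) ≫ (paramCurve w F').hom) := by
    rw [genFibι_fst, CurvePlaces.fromSpecStalk_comp_hom]
    exact isPullback_projMap' K (paramCurve w F').left.functionField (n := 8)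
  have right : IsPullback (CartesianMonoidalCategory.fst (projectiveSpace 8 K) (paramCurve w F')).left
      (CartesianMonoidalCategory.snd (projectiveSpace 8 K) (paramCurve w F')).left (projectiveSpace 8 K).hom (paramCurve w F').hom :=
    IsPullback.of_hasPullback _ _
  exact IsPullback.of_right big (genFibι_snd w F') right

/-- `Spec K(Z) → Z` is flat (`Resolution.flat_fromSpecStalk`). [folklore] -/
instance flat_fromSpecStalk_genericPoint :
    Flat ((paramCurve w F').left.fromSpecStalk (genericPoint (paramCurve w F').left)) :=
  flat_fromSpecStalk _ _

/-- `ι` is quasi-compact (base change of `Spec K(Z) → Z`). [folklore] -/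
instance quasiCompact_genFibι : QuasiCompact (genFibι w F') := by
  haveI : QuasiCompact ((paramCurve w F').left.fromSpecStalk (genericPoint (paramCurve w F').left)) :=
    inferInstanceAs (QuasiCompact (fromSpecFunctionField (paramCurve w F').left))
  exact MorphismProperty.of_isPullback (isPullback_genFibι w F').flip inferInstance

/-- The range of `Spec K(Z) → Z` is the generic point. [folklore] -/
theorem range_fromSpecStalk_genericPoint :
    Set.range ((paramCurve w F').left.fromSpecStalk (genericPoint (paramCurve w F').left)) = {genericPoint (paramCurve w F').left} := by
  ext z
  constructor
  · rintro ⟨p, rfl⟩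
    exact fromSpecFunctionField_apply (paramCurve w F').left p
  · rintro rfl
    exact ⟨closedPoint _, fromSpecFunctionField_apply (paramCurve w F').left _⟩

end GenericFibre

/-! ### The ruled surface: closure of a line of the generic fibre -/

section Surface

open ProjBaseChangeRing

variable {K : Type u} [Field K] [Infinite K] {Y : SchemeOver K} (w : Y.left)
  (F' : Type u) [Field F'] [Algebra (curveField w) F'] [IsProper Y.hom] [FiniteDimensional (curveField w) F']

/-- The function field of the parameter curve is infinite (it contains `K`). [folklore] -/
instance infinite_paramFunctionField : Infinite (paramCurve w F').left.functionField :=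
  Infinite.of_injective _ (algebraMap K (paramCurve w F').left.functionField).injective

variable (𝔇 : LinePencilData (paramCurve w F').left.functionField)

/-- **The ruled surface `S`** (Hirschowitz–Iyer's `H'_Z`, realised in `ℙ⁸ ×_K Z`): the closure of the
line `ℙ(span(u, v)) ⊆ ℙ⁸_{K(Z)}` of the generic fibre, as a closed subvariety of `ℙ⁸ ×_K Z`
(scheme-theoretic image, `ClosedSubvariety.image`). [cite: HirschowitzIyer2010, §2 Lemma 2.2 (proof)] -/
abbrev surf : ClosedSubvariety ((projectiveSpace 8 K) ⊗ paramCurve w F').left :=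
  𝔇.lineSub.image (genFibι w F')

/-- `ℙ⁸ ×_K Z → Spec K` is proper. [folklore] -/
instance isProper_tensor_paramCurve_hom : IsProper ((projectiveSpace 8 K) ⊗ paramCurve w F').hom := by
  haveI : IsProper (projectiveSpace 8 K).hom :=
    inferInstanceAs (IsProper ((ProjSpace.P 8 K) ↘ Spec (.of K)))
  haveI : IsProper (pullback.fst (projectiveSpace 8 K).hom (paramCurve w F').hom) :=
    MorphismProperty.pullback_fst _ _ inferInstance
  exact inferInstanceAs (IsProper (pullback.fst (projectiveSpace 8 K).hom (paramCurve w F').hom ≫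
    (projectiveSpace 8 K).hom))

/-- `ℙ⁸ ×_K Z → Spec K` is locally of finite type. [folklore] -/
instance locallyOfFiniteType_tensor_paramCurve_hom :
    LocallyOfFiniteType ((projectiveSpace 8 K) ⊗ paramCurve w F').hom := inferInstance

/-- `ℙ⁸ ×_K Z` is locally Noetherian. [folklore] -/
instance isLocallyNoetherian_tensor_paramCurve_left :
    IsLocallyNoetherian ((projectiveSpace 8 K) ⊗ (paramCurve w F')).left :=
  LocallyOfFiniteType.isLocallyNoetherian ((projectiveSpace 8 K) ⊗ (paramCurve w F')).hom

omit [Infinite K] in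
/-- **Dimension count along the generic fibre**: `ι` raises heights by `dim Z = dim W`.
[cite: StacksProject, Tag 02JW] -/
theorem height_genFibι (hw : height w = 1)
    (x : ↥(projectiveSpace 8 (paramCurve w F').left.functionField).left) :
    height (genFibι w F' x) = ((1 : ℕ) : ℕ∞) + height x := by
  haveI : IsProper (projectiveSpace 8 K).hom :=
    inferInstanceAs (IsProper ((ProjSpace.P 8 K) ↘ Spec (.of K)))
  have he : height (genericPoint (paramCurve w F').left) = 1 := by
    rw [height_genericPoint_paramCurve, hw]
  have h := dim_image_eq (X := projectiveSpace 8 K) (T := paramCurve w F') (isPullback_genFibι w F')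
    (range_fromSpecStalk_genericPoint w F') he
    (ClosedSubvariety.ofPoint (projectiveSpace 8 (paramCurve w F').left.functionField).left x)
  rw [ClosedSubvariety.dim_ofPoint] at h
  rw [← h]
  change height _ = height ((ClosedSubvariety.ofPoint _ x).image (genFibι w F')).genericPoint
  rw [ClosedSubvariety.genericPoint_image, ClosedSubvariety.genericPoint_ofPoint]

omit [IsProper Y.hom] [FiniteDimensional (curveField w) F'] in
/-- The generic point of `S` is `ι(γ)`. [folklore] -/
theorem genericPoint_surf : (surf w F' 𝔇).genericPoint = genFibι w F' 𝔇.γ := by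
  rw [surf, ClosedSubvariety.genericPoint_image]
  change genFibι w F' (ClosedSubvariety.ofPoint _ 𝔇.γ).genericPoint = _
  rw [ClosedSubvariety.genericPoint_ofPoint]

/-- **`dim S = 2`.** [cite: HirschowitzIyer2010, §2 Lemma 2.2 (proof)] -/
theorem height_genericPoint_surf (hw : height w = 1) :
    height (surf w F' 𝔇).genericPoint = (((1 : ℕ) + 1 : ℕ) : ℕ∞) := by
  rw [genericPoint_surf, height_genFibι w F' hw, 𝔇.height_γ]
  rfl

/-- `S` is locally Noetherian. [folklore] -/
instance isLocallyNoetherian_surf_carrier : IsLocallyNoetherian (surf w F' 𝔇).carrier :=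
  LocallyOfFiniteType.isLocallyNoetherian (surf w F' 𝔇).ι

/-- **`dim S = 2`** on the carrier. [folklore] -/
theorem height_genericPoint_surf_carrier (hw : height w = 1) :
    height (genericPoint (surf w F' 𝔇).carrier) = (((1 : ℕ) + 1 : ℕ) : ℕ∞) := by
  have h := height_genericPoint_surf w F' 𝔇 hw
  erw [height_base_eq_of_isClosedImmersion' (surf w F' 𝔇).ι] at h
  exact h

/-- The marked point `σ̃ = ι(σ)` of `S` (the generic point of the section `H_Z` over `W`).
[folklore] -/
def σS : (surf w F' 𝔇).carrier := 𝔇.lineSub.toImage (genFibι w F') 𝔇.σ'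

/-- The second marked point `τ̃ = ι(τ)` of `S` (the generic point of the hyperplane section).
[folklore] -/
def τS : (surf w F' 𝔇).carrier := 𝔇.lineSub.toImage (genFibι w F') 𝔇.τ'

omit [IsProper Y.hom] [FiniteDimensional (curveField w) F'] in
/-- `σ̃` in `ℙ⁸ ×_K Z`. [folklore] -/
theorem surf_ι_σS : (surf w F' 𝔇).ι (σS w F' 𝔇) = genFibι w F' 𝔇.σ := by
  change (𝔇.lineSub.image (genFibι w F')).ι (𝔇.lineSub.toImage (genFibι w F') 𝔇.σ') = _
  rw [← ι_apply_eq_image_ι_toImage, 𝔇.ι_σ']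

omit [IsProper Y.hom] [FiniteDimensional (curveField w) F'] in
/-- `τ̃` in `ℙ⁸ ×_K Z`. [folklore] -/
theorem surf_ι_τS : (surf w F' 𝔇).ι (τS w F' 𝔇) = genFibι w F' 𝔇.τ := by
  change (𝔇.lineSub.image (genFibι w F')).ι (𝔇.lineSub.toImage (genFibι w F') 𝔇.τ') = _
  rw [← ι_apply_eq_image_ι_toImage, 𝔇.ι_τ']

omit [IsProper Y.hom] [FiniteDimensional (curveField w) F'] in
/-- `σ̃ ≠ τ̃`. [folklore] -/
theorem σS_ne_τS : σS w F' 𝔇 ≠ τS w F' 𝔇 := by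
  intro h
  have h' := congrArg (surf w F' 𝔇).ι h
  rw [surf_ι_σS, surf_ι_τS] at h'
  haveI : IsPreimmersion (genFibι w F') :=
    MorphismProperty.of_isPullback (isPullback_genFibι w F').flip inferInstance
  exact 𝔇.σ_ne_τ ((genFibι w F').isEmbedding.injective h')

/-- `dim closure {σ̃} = 1`. [folklore] -/
theorem height_σS (hw : height w = 1) : height (σS w F' 𝔇) = 1 := by
  rw [← height_base_eq_of_isClosedImmersion' (surf w F' 𝔇).ι, surf_ι_σS, height_genFibι w F' hw, 𝔇.height_σ]
  rfl

/-- `dim closure {τ̃} = 1`. [folklore] -/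
theorem height_τS (hw : height w = 1) : height (τS w F' 𝔇) = 1 := by
  rw [← height_base_eq_of_isClosedImmersion' (surf w F' 𝔇).ι, surf_ι_τS, height_genFibι w F' hw, 𝔇.height_τ]
  rfl

omit [IsProper Y.hom] [FiniteDimensional (curveField w) F'] in
/-- The points of `S` are limits of points of the line: `S = closure (ι (line))`. [folklore] -/
theorem range_surf_ι : Set.range (surf w F' 𝔇).ι =
    closure ((genFibι w F') '' Set.range 𝔇.lineSub.ι) := by
  change Set.range (𝔇.lineSub.ι ≫ genFibι w F').ker.subschemeι = _
  rw [Scheme.IdealSheafData.range_subschemeι, Scheme.Hom.support_ker, Scheme.Hom.comp_base,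
    TopCat.coe_comp, Set.range_comp]

omit [IsProper Y.hom] [FiniteDimensional (curveField w) F'] in
/-- **`S` projects into every hypersurface `V₊(G) ⊆ ℙ⁸_K` containing the generic line**: if the
base change of the `K`-form `G` lies in `𝔭_γ` then `pr₁(S) ⊆ V₊(G)`. [folklore] -/
theorem fst_surf_mem_zeroLocus {G : MvPolynomial (Fin (8 + 1)) K}
    (hG : MvPolynomial.map (algebraMap K (paramCurve w F').left.functionField) G ∈
      ProjectiveSpectrum.asHomogeneousIdeal
        (𝒜 := MvPolynomial.homogeneousSubmodule (Fin (8 + 1)) (paramCurve w F').left.functionField) 𝔇.γ)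
    (s : (surf w F' 𝔇).carrier) :
    (CartesianMonoidalCategory.fst (projectiveSpace 8 K) (paramCurve w F')).left ((surf w F' 𝔇).ι s) ∈
      ProjectiveSpectrum.zeroLocus (MvPolynomial.homogeneousSubmodule (Fin (8 + 1)) K) {G} := by
  set f := (CartesianMonoidalCategory.fst (projectiveSpace 8 K) (paramCurve w F')).left with hf
  set pm := Proj.map (mapGraded K (paramCurve w F').left.functionField (Fin (8 + 1)))
    (irrelevant_le_map K (paramCurve w F').left.functionField (Fin (8 + 1))) with hpm
  -- `pr₁ ∘ ι = Proj.map`, so `pr₁ (ι (closure γ)) ⊆ closure {pm γ} ⊆ V₊(G)`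
  have hcl : IsClosed (ProjectiveSpectrum.zeroLocus (MvPolynomial.homogeneousSubmodule (Fin (8 + 1)) K)
      ({G} : Set (MvPolynomial (Fin (8 + 1)) K))) := ProjectiveSpectrum.isClosed_zeroLocus _ _
  have hγG : pm 𝔇.γ ∈ ProjectiveSpectrum.zeroLocus (MvPolynomial.homogeneousSubmodule (Fin (8 + 1)) K)
      ({G} : Set (MvPolynomial (Fin (8 + 1)) K)) := by
    refine (ProjectiveSpectrum.mem_zeroLocus _ _ _).mpr (Set.singleton_subset_iff.mpr ?_)
    exact (ProjectiveSpectrum.mem_asHomogeneousIdeal_map_iff 𝔇.γ G).mpr hG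
  have hline : ∀ y ∈ Set.range 𝔇.lineSub.ι, f (genFibι w F' y) ∈
      ProjectiveSpectrum.zeroLocus (MvPolynomial.homogeneousSubmodule (Fin (8 + 1)) K)
        ({G} : Set (MvPolynomial (Fin (8 + 1)) K)) := by
    intro y hy
    rw [𝔇.range_lineSub_ι, ← 𝔇.closure_γ] at hy
    have h1 : f (genFibι w F' y) = pm y := by
      rw [hf, hpm, ← Scheme.Hom.comp_apply, genFibι_fst]
      rfl
    rw [h1]
    have h2 : pm y ∈ closure {pm 𝔇.γ} := by
      have h3 : pm y ∈ closure (pm '' {𝔇.γ}) :=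
        (image_closure_subset_closure_image pm.continuous) ⟨y, hy, rfl⟩
      have h4 : (pm '' {𝔇.γ} : Set _) = {pm 𝔇.γ} := Set.image_singleton
      rwa [h4] at h3
    exact (hcl.closure_subset_iff.mpr (Set.singleton_subset_iff.mpr hγG)) h2
  -- points of `S` are limits of points `ι (line)`
  have hs : (surf w F' 𝔇).ι s ∈ closure ((genFibι w F') '' Set.range 𝔇.lineSub.ι) := by
    rw [← range_surf_ι]; exact ⟨s, rfl⟩
  have himg : f '' closure ((genFibι w F') '' Set.range 𝔇.lineSub.ι) ⊆
      ProjectiveSpectrum.zeroLocus (MvPolynomial.homogeneousSubmodule (Fin (8 + 1)) K) {G} := by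
    refine (image_closure_subset_closure_image f.continuous).trans (hcl.closure_subset_iff.mpr ?_)
    rintro _ ⟨_, ⟨y, hy, rfl⟩, rfl⟩
    exact hline y hy
  exact himg ⟨_, hs, rfl⟩

end Surface

/-! ### The ruled surface of a curve on `V₊(Q, C) ⊂ ℙ⁸` -/

section QuadricCubic

open ProjBaseChangeRing StrongLineCover

variable {K : Type u} [Field K] {Q C : MvPolynomial (Fin (8 + 1)) K}

/-- **The generic strong line of a curve on `V₊(Q, C)`**, bundled: homogeneous coordinates `p` of the
generic point of `W = closure {w}`, a finite extension `F'` of `K(W)`, and a `3`-fat line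
`span(u, v) ∋ p` with witness plane `span(u, v, y)` over `F'`
(`exists_genericStrongLine` of `Motives/HirschowitzIyerCurveData`). [cite: HirschowitzIyer2010, §2 Lemma 2.2 (proof)] -/
structure GenericStrongLine (Q C : MvPolynomial (Fin (8 + 1)) K) (w : ↥(quadricCubic Q C).left) where
  /-- homogeneous coordinates of the generic point of `W` -/
  p : Fin (8 + 1) → curveField w
  hp : p ≠ 0
  hP : ProjectiveSpace.pointOfVec K p hp = AlgPoints.map (completeIntersectionι ![Q, C]) (genericAlgPoint w)
  /-- the field of definition of the generic strong line -/
  F' : IntermediateField (curveField w) (AlgebraicClosure (curveField w))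
  fd : FiniteDimensional (curveField w) F'
  /-- the fat flag -/
  u : Fin 9 → F'
  v : Fin 9 → F'
  y : Fin 9 → F'
  α : F'
  β : F'
  hli : LinearIndependent F' ![u, v, y]
  hpuv : (algebraMap (curveField w) F' ∘ p) = α • u + β • v
  hQ : ∀ c : Fin 3 → F', MvPolynomial.eval (comb u v y c)
    (MvPolynomial.map ((algebraMap (curveField w) F').comp (algebraMap K (curveField w))) Q) = 0
  hC : ∀ c : Fin 3 → F', MvPolynomial.eval (comb u v y c)
      (MvPolynomial.map ((algebraMap (curveField w) F').comp (algebraMap K (curveField w))) C) =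
    c 2 ^ 3 * MvPolynomial.eval y
      (MvPolynomial.map ((algebraMap (curveField w) F').comp (algebraMap K (curveField w))) C)

/-- Generic strong lines exist (characteristic zero). [cite: HirschowitzIyer2010, §2 Lemma 2.2 (proof) with §6 Prop. 6.1] -/
theorem nonempty_genericStrongLine [CharZero K] (hQ : Q.IsHomogeneous 2) (hC : C.IsHomogeneous 3)
    (w : ↥(quadricCubic Q C).left) : Nonempty (GenericStrongLine Q C w) := by
  obtain ⟨p, hp, hP, F', hfd, u, v, y, α, β, hli, hspan, hQv, hCv⟩ := exists_genericStrongLine hQ hC w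
  exact ⟨⟨p, hp, hP, F', hfd, u, v, y, α, β, hli, hspan, hQv, hCv⟩⟩

namespace GenericStrongLine

variable {w : ↥(quadricCubic Q C).left} (𝔏 : GenericStrongLine Q C w)

/-- Bookkeeping. [folklore] -/
instance finiteDimensional_F' : FiniteDimensional (curveField w) 𝔏.F' := 𝔏.fd

/-- The parameter curve `Z` of the generic strong line. [folklore] -/
abbrev Z : SchemeOver K := paramCurve w (𝔏.F' : Type u)

/-- Its function field `K(Z)`. [folklore] -/
abbrev Kz : Type u := (𝔏.Z).left.functionField

/-- `F' ≃ₐ[K] K(Z)`. [folklore] -/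
def e : (𝔏.F' : Type u) ≃ₐ[K] 𝔏.Kz := (funFieldAlgEquiv w (𝔏.F' : Type u)).symm

/-- The map `K(W) → K(Z)` as a `K`-algebra map: `e ∘ (K(W) ⊆ F')`. [folklore] -/
def φW : curveField w →ₐ[K] 𝔏.Kz :=
  (𝔏.e : (𝔏.F' : Type u) →ₐ[K] 𝔏.Kz).comp (IsScalarTower.toAlgHom K (curveField w) 𝔏.F')

/-- The structure map `K → K(Z)` factors through `e`. [folklore] -/
theorem algebraMap_Kz : algebraMap K 𝔏.Kz =
    (𝔏.e : (𝔏.F' : Type u) →+* 𝔏.Kz).comp ((algebraMap (curveField w) 𝔏.F').comp (algebraMap K (curveField w))) := by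
  ext c
  simp only [RingHom.coe_comp, RingHom.coe_coe, Function.comp_apply]
  rw [← IsScalarTower.algebraMap_apply K (curveField w) 𝔏.F' c, AlgEquiv.commutes]

/-- The spanning vectors and the marked vector over `K(Z)`. [folklore] -/
def uz : Fin (8 + 1) → 𝔏.Kz := 𝔏.e ∘ 𝔏.u
/-- The spanning vectors and the marked vector over `K(Z)`. [folklore] -/
def vz : Fin (8 + 1) → 𝔏.Kz := 𝔏.e ∘ 𝔏.v
/-- The spanning vectors and the marked vector over `K(Z)`. [folklore] -/
def yz : Fin (8 + 1) → 𝔏.Kz := 𝔏.e ∘ 𝔏.y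
/-- The spanning vectors and the marked vector over `K(Z)`. [folklore] -/
def pz : Fin (8 + 1) → 𝔏.Kz := 𝔏.φW ∘ 𝔏.p

/-- Bookkeeping. [folklore] -/
theorem pz_eq : 𝔏.pz = 𝔏.e 𝔏.α • 𝔏.uz + 𝔏.e 𝔏.β • 𝔏.vz := by
  funext i
  have h := congrFun 𝔏.hpuv i
  simp only [Function.comp_apply, Pi.add_apply, Pi.smul_apply, smul_eq_mul] at h ⊢
  change 𝔏.e (algebraMap (curveField w) 𝔏.F' (𝔏.p i)) = _
  rw [h, map_add, map_mul, map_mul]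
  rfl

/-- Bookkeeping. [folklore] -/
theorem pz_ne_zero : 𝔏.pz ≠ 0 := by
  obtain ⟨i, hi⟩ := Function.ne_iff.mp 𝔏.hp
  refine Function.ne_iff.mpr ⟨i, ?_⟩
  change 𝔏.φW (𝔏.p i) ≠ 0
  exact (map_ne_zero _).mpr hi

/-- Bookkeeping. [folklore] -/
theorem linearIndependent_uz_vz : LinearIndependent 𝔏.Kz ![𝔏.uz, 𝔏.vz] := by
  have h3 : LinearIndependent 𝔏.Kz (fun i => (𝔏.e : (𝔏.F' : Type u) ≃+* 𝔏.Kz) ∘ (![𝔏.u, 𝔏.v, 𝔏.y] i)) :=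
    ProjFamily.linearIndependent_comp_ringEquiv (𝔏.e : (𝔏.F' : Type u) ≃+* 𝔏.Kz) 𝔏.hli
  have h2 := h3.comp (Fin.castSucc : Fin 2 → Fin 3) (Fin.castSucc_injective 2)
  have heq : (fun i => (𝔏.e : (𝔏.F' : Type u) ≃+* 𝔏.Kz) ∘ (![𝔏.u, 𝔏.v, 𝔏.y] i)) ∘ (Fin.castSucc : Fin 2 → Fin 3) =
      ![𝔏.uz, 𝔏.vz] := by
    funext i; fin_cases i <;> rfl
  rwa [heq] at h2

/-- Vectors of `span(u, v)` over `K(Z)` come from `span(u, v)` over `F'`. [folklore] -/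
theorem exists_comb_of_mem_span {q : Fin (8 + 1) → 𝔏.Kz}
    (hq : q ∈ Submodule.span 𝔏.Kz (Set.range ![𝔏.uz, 𝔏.vz])) :
    ∃ c : Fin 3 → 𝔏.F', c 2 = 0 ∧ q = 𝔏.e ∘ comb 𝔏.u 𝔏.v 𝔏.y c := by
  rw [Matrix.range_cons_cons_empty, Submodule.mem_span_pair] at hq
  obtain ⟨a, b, rfl⟩ := hq
  refine ⟨![𝔏.e.symm a, 𝔏.e.symm b, 0], rfl, ?_⟩
  funext i
  simp [comb, uz, vz]

/-- The index of a non-zero coordinate of `p`. [folklore] -/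
def c₀ : Fin (8 + 1) := ProjectiveSpace.firstNe 𝔏.p 𝔏.hp

variable [Infinite K]

/-- **The line data of the generic fibre**: the line `ℙ(span(u, v)) ⊆ ℙ⁸_{K(Z)}` with marked vector
`p` and hyperplane `x_{c₀} = 0`. [folklore] -/
def lineData : LinePencilData 𝔏.Kz where
  u := 𝔏.uz
  v := 𝔏.vz
  p := 𝔏.pz
  α := 𝔏.e 𝔏.α
  β := 𝔏.e 𝔏.β
  hli := 𝔏.linearIndependent_uz_vz
  hp := 𝔏.pz_eq
  hp0 := 𝔏.pz_ne_zero
  m := MvPolynomial.X 𝔏.c₀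
  hm := MvPolynomial.isHomogeneous_X _ _
  hmp := by
    rw [MvPolynomial.eval_X]
    change 𝔏.φW (𝔏.p 𝔏.c₀) ≠ 0
    exact (map_ne_zero _).mpr (ProjectiveSpace.apply_firstNe_ne_zero 𝔏.p 𝔏.hp)

/-- **`Q` vanishes on the generic line**: `Q ⊗ 1 ∈ 𝔭_γ`. [cite: HirschowitzIyer2010, §2 Lemma 2.2 (proof)] -/
theorem map_Q_mem_γ : MvPolynomial.map (algebraMap K 𝔏.Kz) Q ∈
    ProjectiveSpectrum.asHomogeneousIdeal (𝒜 := MvPolynomial.homogeneousSubmodule (Fin (8 + 1)) 𝔏.Kz) 𝔏.lineData.γ := by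
  refine 𝔏.lineData.mem_γ_of_forall_eval_eq_zero fun q hq => ?_
  obtain ⟨c, -, rfl⟩ := 𝔏.exists_comb_of_mem_span hq
  rw [𝔏.algebraMap_Kz, ← MvPolynomial.map_map]
  have h := eval_map_comp (𝔏.e : (𝔏.F' : Type u) →+* 𝔏.Kz) (comb 𝔏.u 𝔏.v 𝔏.y c)
    (MvPolynomial.map ((algebraMap (curveField w) 𝔏.F').comp (algebraMap K (curveField w))) Q)
  rw [𝔏.hQ c, map_zero] at h
  exact h

/-- **`C` vanishes on the generic line**: `C ⊗ 1 ∈ 𝔭_γ`. [cite: HirschowitzIyer2010, §2 Lemma 2.2 (proof)] -/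
theorem map_C_mem_γ : MvPolynomial.map (algebraMap K 𝔏.Kz) C ∈
    ProjectiveSpectrum.asHomogeneousIdeal (𝒜 := MvPolynomial.homogeneousSubmodule (Fin (8 + 1)) 𝔏.Kz) 𝔏.lineData.γ := by
  refine 𝔏.lineData.mem_γ_of_forall_eval_eq_zero fun q hq => ?_
  obtain ⟨c, hc2, rfl⟩ := 𝔏.exists_comb_of_mem_span hq
  rw [𝔏.algebraMap_Kz, ← MvPolynomial.map_map]
  have h := eval_map_comp (𝔏.e : (𝔏.F' : Type u) →+* 𝔏.Kz) (comb 𝔏.u 𝔏.v 𝔏.y c)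
    (MvPolynomial.map ((algebraMap (curveField w) 𝔏.F').comp (algebraMap K (curveField w))) C)
  rw [𝔏.hC c, hc2] at h
  simpa using h

/-! ### The ruled surface over the quadric -/

omit [Infinite K] in
/-- `V₊(Q, C) → Spec K` is proper (a closed subscheme of `ℙ⁸`). [folklore] -/
instance _root_.Literature.AlgebraicGeometry.Motives.isProper_quadricCubic_hom {n : ℕ}
    (Q C : MvPolynomial (Fin (n + 1)) K) : IsProper (quadricCubic Q C).hom := by
  haveI : IsProper (projectiveSpace n K).hom := inferInstanceAs (IsProper ((ProjSpace.P n K) ↘ Spec (.of K)))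
  exact inferInstanceAs (IsProper ((completeIntersectionι ![Q, C]).left ≫ (projectiveSpace n K).hom))

omit [Infinite K] in
/-- `V₊(Q) → Spec K` is proper. [folklore] -/
instance _root_.Literature.AlgebraicGeometry.Motives.isProper_quadric_hom {n : ℕ}
    (Q : MvPolynomial (Fin (n + 1)) K) : IsProper (quadric Q).hom := by
  haveI : IsProper (projectiveSpace n K).hom := inferInstanceAs (IsProper ((ProjSpace.P n K) ↘ Spec (.of K)))
  exact inferInstanceAs (IsProper ((completeIntersectionι (fun _ : Fin 1 => Q)).left ≫ (projectiveSpace n K).hom))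

/-- **The ruled surface `S` of the generic strong line** (HI's `H'_Z`), in `ℙ⁸ ×_K Z`.
[cite: HirschowitzIyer2010, §2 Lemma 2.2 (proof)] -/
abbrev S : ClosedSubvariety ((projectiveSpace 8 K) ⊗ 𝔏.Z).left := surf w (𝔏.F' : Type u) 𝔏.lineData

/-- `S` over `K`. [folklore] -/
abbrev So : SchemeOver K := (𝔏.S).over ((projectiveSpace 8 K) ⊗ 𝔏.Z).hom

/-- The projection `S → ℙ⁸_K`. [folklore] -/
abbrev prS : (𝔏.S).carrier ⟶ ↑(projectiveSpace 8 K).left :=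
  (𝔏.S).ι ≫ (CartesianMonoidalCategory.fst (projectiveSpace 8 K) 𝔏.Z).left

/-- The embedding `V₊(Q) ↪ ℙ⁸` in the `projectiveSpace` spelling. [folklore] -/
abbrev iQ : ↑(quadric Q).left ⟶ ↑(projectiveSpace 8 K).left := (completeIntersectionι (fun _ : Fin 1 => Q)).left

/-- **`pr₁(S) ⊆ V₊(Q)`.** [cite: HirschowitzIyer2010, §2 Lemma 2.2 (proof)] -/
theorem prS_mem_range_iQ (s : (𝔏.S).carrier) : 𝔏.prS s ∈ Set.range (iQ (Q := Q)) := by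
  have hr : Set.range (iQ (Q := Q)) = ProjectiveSpectrum.zeroLocus
      (MvPolynomial.homogeneousSubmodule (Fin (8 + 1)) K) (Set.range (fun _ : Fin 1 => Q)) :=
    range_completeIntersectionι _
  rw [hr]
  have h := fst_surf_mem_zeroLocus w (𝔏.F' : Type u) 𝔏.lineData 𝔏.map_Q_mem_γ s
  refine (ProjectiveSpectrum.mem_zeroLocus _ _ _).mpr ?_
  rintro _ ⟨j, rfl⟩
  exact Set.singleton_subset_iff.mp ((ProjectiveSpectrum.mem_zeroLocus _ _ _).mp h)

/-- **`pr₁(S) ⊆ V₊(C)`.** [cite: HirschowitzIyer2010, §2 Lemma 2.2 (proof)] -/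
theorem prS_mem_zeroLocus_C (s : (𝔏.S).carrier) : 𝔏.prS s ∈
    ProjectiveSpectrum.zeroLocus (MvPolynomial.homogeneousSubmodule (Fin (8 + 1)) K) {C} :=
  fst_surf_mem_zeroLocus w (𝔏.F' : Type u) 𝔏.lineData 𝔏.map_C_mem_γ s

/-- The kernel condition for lifting `S → ℙ⁸` through `V₊(Q) ↪ ℙ⁸` (`S` is reduced and maps into the
closed set `V₊(Q)`). [folklore] -/
theorem ker_iQ_le : (iQ (Q := Q)).ker ≤ (𝔏.prS).ker := by
  have hker_eq : ∀ {V : Scheme.{u}} [IsReduced V] (f : V ⟶ ↑(projectiveSpace 8 K).left),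
      f.ker = Scheme.IdealSheafData.vanishingIdeal (Closeds.closure (Set.range f)) := by
    intro V _ f
    rw [← Scheme.IdealSheafData.map_bot, ← Scheme.nilradical_eq_bot,
      ← Scheme.IdealSheafData.vanishingIdeal_top, Scheme.IdealSheafData.map_vanishingIdeal,
      Closeds.coe_top, Set.image_univ]
  rw [hker_eq (iQ (Q := Q)), hker_eq 𝔏.prS]
  refine Scheme.IdealSheafData.vanishingIdeal_antimono (Closeds.closure_le.2 ?_)
  change Set.range 𝔏.prS ⊆ closure (Set.range (iQ (Q := Q)))
  rintro _ ⟨s, rfl⟩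
  exact subset_closure (𝔏.prS_mem_range_iQ s)

/-- **The projection `π : S → V₊(Q)`** (HI's `pr₂ |_{H'_Z} : H'_Z → Y'`), over `K`. [cite: HirschowitzIyer2010, §2 Lemma 2.2 (proof)] -/
def πq : 𝔏.So ⟶ quadric Q :=
  Over.homMk (IsClosedImmersion.lift (iQ (Q := Q)) 𝔏.prS 𝔏.ker_iQ_le) (by
    change IsClosedImmersion.lift (iQ (Q := Q)) 𝔏.prS 𝔏.ker_iQ_le ≫ iQ (Q := Q) ≫ (projectiveSpace 8 K).hom =
      (𝔏.S).ι ≫ ((projectiveSpace 8 K) ⊗ 𝔏.Z).hom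
    rw [IsClosedImmersion.lift_fac_assoc]
    rfl)

/-- `π ≫ (V₊(Q) ↪ ℙ⁸) = S ↪ ℙ⁸ × Z → ℙ⁸`. [folklore] -/
@[reassoc]
theorem πq_left_iQ : (𝔏.πq).left ≫ iQ (Q := Q) = 𝔏.prS :=
  IsClosedImmersion.lift_fac _ _ _

/-- Pointwise form. [folklore] -/
theorem iQ_πq (s : (𝔏.S).carrier) : iQ (Q := Q) ((𝔏.πq).left s) = 𝔏.prS s := by
  rw [← Scheme.Hom.comp_apply, πq_left_iQ]
  rfl

/-- Pointwise form in the `quadricι` spelling. [folklore] -/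
theorem quadricι_πq (s : (𝔏.S).carrier) : quadricι Q ((𝔏.πq).left s) = 𝔏.prS s :=
  𝔏.iQ_πq s

/-- `π : S → V₊(Q)` is proper. [folklore] -/
instance isProper_πq_left : IsProper (𝔏.πq).left := by
  haveI : IsProper ((𝔏.πq).left ≫ iQ (Q := Q)) := by
    rw [πq_left_iQ]
    haveI : IsProper (CartesianMonoidalCategory.fst (projectiveSpace 8 K) 𝔏.Z).left :=
      MorphismProperty.pullback_fst _ _ inferInstance
    exact inferInstanceAs (IsProper ((𝔏.S).ι ≫ (CartesianMonoidalCategory.fst (projectiveSpace 8 K) 𝔏.Z).left))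
  exact IsProper.of_comp _ (iQ (Q := Q))

/-- **The marked point of `S` lies over `w`** (through `ℙ⁸`): `pr₁ σ̃ = w`. [cite: HirschowitzIyer2010, §2 Lemma 2.2 (proof)] -/
theorem prS_σS : 𝔏.prS (σS w (𝔏.F' : Type u) 𝔏.lineData) = (completeIntersectionι ![Q, C]).left w := by
  change (CartesianMonoidalCategory.fst (projectiveSpace 8 K) 𝔏.Z).left ((𝔏.S).ι (σS w (𝔏.F' : Type u) 𝔏.lineData)) = _
  rw [surf_ι_σS, ← Scheme.Hom.comp_apply, genFibι_fst]
  -- `Proj.map [pz] = [pz]_K = [p]_K = w`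
  have h1 : (ProjectiveSpace.pointOfVec 𝔏.Kz 𝔏.pz 𝔏.pz_ne_zero).left ≫
      Proj.map (mapGraded K 𝔏.Kz (Fin (8 + 1))) (irrelevant_le_map K 𝔏.Kz (Fin (8 + 1))) =
      (ProjectiveSpace.pointOfVec K 𝔏.pz 𝔏.pz_ne_zero).left :=
    ProjectiveSpace.pointOfVec_left_comp_projMap (k := K) 𝔏.pz 𝔏.pz_ne_zero
  have h2 : (ProjectiveSpace.pointOfVec K 𝔏.pz 𝔏.pz_ne_zero).pt = (ProjectiveSpace.pointOfVec K 𝔏.p 𝔏.hp).pt :=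
    ProjectiveSpace.pt_pointOfVec_comp_algHom 𝔏.φW 𝔏.p 𝔏.hp
  calc (Proj.map (mapGraded K 𝔏.Kz (Fin (8 + 1))) (irrelevant_le_map K 𝔏.Kz (Fin (8 + 1)))) 𝔏.lineData.σ
      = ((ProjectiveSpace.pointOfVec 𝔏.Kz 𝔏.pz 𝔏.pz_ne_zero).left ≫
          Proj.map (mapGraded K 𝔏.Kz (Fin (8 + 1))) (irrelevant_le_map K 𝔏.Kz (Fin (8 + 1)))) (closedPoint 𝔏.Kz) := rfl
    _ = (ProjectiveSpace.pointOfVec K 𝔏.pz 𝔏.pz_ne_zero).pt := by rw [h1]; rfl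
    _ = (completeIntersectionι ![Q, C]).left w := by
        rw [h2, 𝔏.hP, AlgPoints.pt_map, genericAlgPoint_pt]

/-- **`π σ̃ = w`** in `V₊(Q)`. [cite: HirschowitzIyer2010, §2 Lemma 2.2 (proof)] -/
theorem πq_σS : (𝔏.πq).left (σS w (𝔏.F' : Type u) 𝔏.lineData) = (quadricCubicToQuadric Q C).left w := by
  apply (iQ (Q := Q)).isClosedEmbedding.injective
  have e1 : (completeIntersectionι ![Q, C]).left w = iQ (Q := Q) ((quadricCubicToQuadric Q C).left w) := by
    rw [← Scheme.Hom.comp_apply, ← Over.comp_left, quadricCubicToQuadric_ι]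
  rw [iQ_πq, prS_σS, e1]

/-- **Every point of `π(S)` has closure inside `V₊(C)`** (so the whole surface maps into
`Y = V₊(Q, C)`). [cite: HirschowitzIyer2010, §2 Lemma 2.2 (proof)] -/
theorem closure_quadricι_πq_subset (s : (𝔏.S).carrier) :
    closure {quadricι Q ((𝔏.πq).left s)} ⊆
      ProjectiveSpectrum.zeroLocus (MvPolynomial.homogeneousSubmodule (Fin (8 + 1)) K) {C} := by
  rw [quadricι_πq]
  exact (ProjectiveSpectrum.isClosed_zeroLocus _ _).closure_subset_iff.mpr
    (Set.singleton_subset_iff.mpr (𝔏.prS_mem_zeroLocus_C s))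

end GenericStrongLine

end QuadricCubic

end Literature.AlgebraicGeometry.Motives

end
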